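import Mathlib
import Literature.MathematicalPhysics.QuantumFieldTheory.BalabanBanachStep
import Summits.QuantumFields.YangMills.Theses.ParabolicTrajectory

/-!
# Sketch — first lemmas of the crux idea cards for `LatticeGapOnTrajectory` (stmt-QuantumFields-10523)

Ideator 2, round 1. Two cards:

* `rt-arc-collapse`      — first lemma `WilsonOrbitsCollapse` (pure Banach-space dynamics over the
  route's hypothesis structure `BalabanBanachStep` and the conclusion data of the route decl
  `ParabolicCentreCurve`);
* `dissipative-bridge`   — first lemma `TailTrapping` (Zgliczyński–Mischaikow self-consistent
  bounds, map version, over an abstract Banach space with a continuous linear idempotent `P`).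

Both are `Prop` definitions (statements only); nothing is proved here.
-/

namespace Summit.QuantumFields.YangMills.Cruxes.LatticeGapOnTrajectory.Sketch

open Literature.MathematicalPhysics.QuantumFieldTheory

/-- **First lemma of card `rt-arc-collapse` (collapse of tuned Wilson orbits onto the
renormalised trajectory).** Let `S : BalabanBanachStep G r M` and let `(h, δ', K, θ₁)` be
centre-unstable-curve data with the ATTRACTION clause of `ParabolicCentreCurve` (orbit segments
staying in the `δ'`-chart approach the graph of `h` at rate `K θ₁^k`). Then for every landing
coupling `γ ∈ (0, δ']` and every `ε > 0` there is `g₁ > 0` such that every Wilson orbit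
`F^[k] (g, yW g)` started at bare coupling `g ∈ (0, g₁]`, whose running coupling has stayed in
`[0, δ']` up to step `k` and has reached `γ` at step `k`, is `ε`-close to the curve at step `k`.
(Reason: reaching `γ` from `g` takes `≳ (g⁻² − γ⁻²)/b` steps, basin contraction `θ'` brings the
fibre coordinate into the chart after `O(log(R/δ'))` steps, then attraction acts for the
remaining `→ ∞` steps.) Along a tuned sequence `β_k → ∞` (Wilson points `g_k → 0⁺`) this says:
ALL sequences land, at coupling `γ`, in an arbitrarily small neighbourhood of the compact arc
`{(g, h g) : g ∈ [γ, φ γ (h γ)]}` of the trajectory. -/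
def WilsonOrbitsCollapse : Prop :=
  ∀ (G : Type) [Group G] [TopologicalSpace G] [IsTopologicalGroup G] [CompactSpace G]
    [MeasurableSpace G] [BorelSpace G] (r : LatticeRep G) (M : ℕ) (S : BalabanBanachStep G r M)
    (δ' K θ₁ : ℝ) (h : ℝ → S.E),
    0 < δ' → δ' ≤ S.δ → 0 ≤ K → 0 ≤ θ₁ → θ₁ < 1 →
    -- the curve stays inside the chart ball
    (∀ g ∈ Set.Icc 0 δ', ‖h g‖ ≤ δ') →
    -- ATTRACTION (the last clause of `ParabolicCentreCurve`, verbatim shape)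
    (∀ (p : ℝ × S.E) (k : ℕ),
        (∀ j ≤ k, (S.F^[j] p).1 ∈ Set.Icc 0 δ' ∧ ‖(S.F^[j] p).2‖ ≤ δ') →
          ‖(S.F^[k] p).2 - h (S.F^[k] p).1‖ ≤ K * θ₁ ^ k * ‖p.2 - h p.1‖) →
    -- BASIN: the `R`-ball is forward invariant in the fibre while the coupling is in the chart …
    (∀ p : ℝ × S.E, p.1 ∈ Set.Icc 0 δ' → ‖p.2‖ ≤ S.R → ‖(S.F p).2‖ ≤ S.R) →
    -- … and the `δ'`-ball absorbs it after `j₀` steps (basin contraction `θ'` + `‖Ψ g 0‖ = O(g²)`)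
    (∃ j₀ : ℕ, ∀ (p : ℝ × S.E) (k : ℕ), ‖p.2‖ ≤ S.R →
        (∀ j ≤ k, (S.F^[j] p).1 ∈ Set.Icc 0 δ') → j₀ ≤ k → ‖(S.F^[k] p).2‖ ≤ δ') →
    ∀ γ ∈ Set.Ioc 0 δ', ∀ ε : ℝ, 0 < ε →
      ∃ g₁ : ℝ, 0 < g₁ ∧ g₁ ≤ S.g₀ ∧
        ∀ g ∈ Set.Ioc 0 g₁, ∀ k : ℕ,
          (∀ j ≤ k, (S.F^[j] (g, S.yW g)).1 ∈ Set.Icc 0 δ') →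
          γ ≤ (S.F^[k] (g, S.yW g)).1 →
            ‖(S.F^[k] (g, S.yW g)).2 - h (S.F^[k] (g, S.yW g)).1‖ ≤ ε

/-- **First lemma of card `dissipative-bridge` (self-consistent bounds / tail trapping, after
Zgliczyński–Mischaikow, for MAPS).** `E` a real Banach space, `P : E →L[ℝ] E` idempotent (the
Galerkin projection onto finitely many relevant + slow couplings; `1 − P` = the dissipative tail
of irrelevant directions), `F : E → E` the (global-chart) block-spin map, `N 0, …, N J ⊆ range P`
a chain of "Galerkin boxes" (interval enclosures produced by the computer). IF on each box the
tail of the image contracts (`‖(1−P) F (x + w)‖ ≤ θ ‖w‖ + η` for all admissible tails `w`,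
`θ < 1`, `η ≤ (1−θ) ρ`) AND the projected image of box `i` with ANY admissible tail lies in box
`i+1` (the finite, certified covering computation), THEN every full orbit started in
`N 0 ⊕ {tail ≤ ρ}` stays in `N i ⊕ {tail ≤ ρ}` for `i ≤ J`. (Induction on `i`; the point of the
card is that the block-spin map IS tail-dissipative transverse to the renormalised trajectory —
the route's `‖A‖ ≤ θ < 1` — so a finite computation on `range P` encloses the infinite-dimensional
continuation of the trajectory until it enters the strong-coupling polymer-expansion ball.) -/
def TailTrapping : Prop :=
  ∀ (E : Type) [NormedAddCommGroup E] [NormedSpace ℝ E] [CompleteSpace E]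
    (P : E →L[ℝ] E) (F : E → E) (N : ℕ → Set E) (ρ θ η : ℝ) (J : ℕ),
    (∀ x, P (P x) = P x) → 0 ≤ ρ → 0 ≤ θ → θ < 1 → 0 ≤ η → η ≤ (1 - θ) * ρ →
    (∀ i, ∀ x ∈ N i, P x = x) →
    (∀ i < J, ∀ x ∈ N i, ∀ w : E, P w = 0 → ‖w‖ ≤ ρ →
        ‖F (x + w) - P (F (x + w))‖ ≤ θ * ‖w‖ + η) →
    (∀ i < J, ∀ x ∈ N i, ∀ w : E, P w = 0 → ‖w‖ ≤ ρ → P (F (x + w)) ∈ N (i + 1)) →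
    ∀ z : E, P z ∈ N 0 → ‖z - P z‖ ≤ ρ →
      ∀ i ≤ J, P (F^[i] z) ∈ N i ∧ ‖F^[i] z - P (F^[i] z)‖ ≤ ρ

/-- The crux decl both cards aim at (rev 4), named here so the sketch fails loudly if the route
file changes under us. -/
example : Prop := Summit.QuantumFields.YangMills.Theses.ParabolicTrajectory.LatticeGapOnTrajectory

end Summit.QuantumFields.YangMills.Cruxes.LatticeGapOnTrajectory.Sketch
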